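import Literature.Probability.LatticeModels.RandomClusterIsoInvariance
import Literature.Probability.LatticeModels.RandomClusterEdgeWeights
import Literature.Probability.Percolation.SubgraphMonotonicity
import HarnessLib

/-!
# Invariance of the edge-parameter random-cluster measure `φ^B_{𝐩,q}` under relabelling of the vertices

Topic `Literature/Probability/LatticeModels`.  Grimmett 2006, §1.4 eq. (1.20) defines `φ_{𝐩,q}` with a parameter VECTOR
`𝐩 = (p_e)`; §4.3 uses throughout that the random-cluster measure "is invariant under automorphisms of the graph".  The tree has the
invariance for the homogeneous measure `rcMeasure G p q B` (`RandomClusterIsoInvariance.lean`: `clusterCount_relabel`, `rcWeight_relabel`,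
`rcMeasure_real_preimage_relabel`).  This file is the same bookkeeping for the edge-parameter measure `rcMeasureW w q B`
(`RandomClusterEdgeWeights.lean`) along a bijection of vertex types `e : V ≃ W` (parameters pulled back along `sym2Equiv e`, wired set
pushed forward): the tool that moves finite-graph statements typed over `Fin n` (the FK analogues of the Kozma–Nitzan family in
`Summits/…/Theorems/…FK*.lean`) to an arbitrary finite vertex type.

* `BHK2006.weight_relabel`, `rcWeightW_relabel`, `rcPartitionFunctionW_relabel` — weights and partition function;
* `rcMeasureW_real_preimage_relabel` — `φ^B_{𝐩∘e,q}{ω | e ω ∈ A} = φ^{e B}_{𝐩,q}(A)` (`0 < q`);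
* `rcMeasureW_map_relabel` — the push-forward form `(φ^B_{𝐩∘e,q}).map (relabel e) = φ^{e B}_{𝐩,q}`;
* `integral_rcMeasureW_relabel` — `∫ g dφ^{e B}_{𝐩,q} = ∫ g ∘ (relabel e) dφ^B_{𝐩∘e,q}`;
* `relabel_sym2Equiv_eq_restrictConfig_symm` — the relabelling `ω ↦ e ω` is the restriction coupling along `e⁻¹`
  (`restrictConfig e.symm`, `SubgraphMonotonicity.lean`), so the event dictionary of `KozmaNitzanPinning.lean` applies.
[cite: Grimmett2006, §1.4 eq. (1.20) (p. 15); §4.3 (automorphism invariance)]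
-/

noncomputable section

open MeasureTheory Literature.Probability.Percolation

namespace Literature.Probability.LatticeModels

variable {V W : Type*}

/-- Relabelling along `e` is restriction along `e⁻¹`: `e ω = {z | z.map e⁻¹ ∈ ω}` (the relabelled configuration of Grimmett 1999 §1.6 /
Grimmett 2006 §4.3 written as the restriction coupling of `SubgraphMonotonicity.lean`). [cite: Grimmett2006, §4.3 (automorphism invariance)] -/
theorem relabel_sym2Equiv_eq_restrictConfig_symm (e : V ≃ W) (ω : BondConfig V) :
    BondConfig.relabel (sym2Equiv e) ω = restrictConfig e.symm ω := by
  ext z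
  rw [BondConfig.mem_relabel_iff, mem_restrictConfig, sym2Equiv_symm, sym2Equiv_apply]

variable [Fintype V] [Fintype W]

/-- **Product weights are invariant under relabelling** (parameters pulled back along `sym2Equiv e`).
[cite: Grimmett2006, §1.4 eq. (1.20) (p. 15)] -/
theorem BHK2006.weight_relabel (e : V ≃ W) (w : Sym2 W → ℝ) (ω : BondConfig V) :
    BHK2006.weight w (BondConfig.relabel (sym2Equiv e) ω) = BHK2006.weight (w ∘ sym2Equiv e) ω := by
  classical
  unfold BHK2006.weight
  symm
  refine Fintype.prod_equiv (sym2Equiv e) _ _ fun z => ?_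
  have hz : sym2Equiv e z ∈ BondConfig.relabel (sym2Equiv e) ω ↔ z ∈ ω := by
    rw [BondConfig.mem_relabel_iff, Equiv.symm_apply_apply]
  simp only [Function.comp_apply, hz]

/-- **Random-cluster weights with edge parameters are invariant under relabelling**:
`w_{𝐩,q}^{e B}(e ω) = w_{𝐩∘e,q}^{B}(ω)`. [cite: Grimmett2006, §1.4 eq. (1.20) (p. 15); §4.3] -/
theorem rcWeightW_relabel (e : V ≃ W) (w : Sym2 W → unitInterval) (q : ℝ) (B : Set V) (ω : BondConfig V) :
    rcWeightW w q (e '' B) (BondConfig.relabel (sym2Equiv e) ω) = rcWeightW (w ∘ sym2Equiv e) q B ω := by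
  unfold rcWeightW
  rw [clusterCount_relabel]
  congr 1
  exact BHK2006.weight_relabel e (fun z => (w z : ℝ)) ω

/-- **Partition functions are invariant under relabelling**: `Z^{e B}_{𝐩,q} = Z^{B}_{𝐩∘e,q}`. [cite: Grimmett2006, §1.4 eq. (1.20) (p. 15); §4.3] -/
theorem rcPartitionFunctionW_relabel (e : V ≃ W) (w : Sym2 W → unitInterval) (q : ℝ) (B : Set V) :
    rcPartitionFunctionW w q (e '' B) = rcPartitionFunctionW (w ∘ sym2Equiv e) q B := by
  unfold rcPartitionFunctionW
  symm
  exact Fintype.sum_equiv (BondConfig.relabel (sym2Equiv e)).toEquiv _ _ fun ω => (rcWeightW_relabel e w q B ω).symm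

/-- **The edge-parameter random-cluster measure is invariant under relabelling** (`0 < q`): for every event `A` of
`W`-configurations, `φ^B_{𝐩∘e,q}{ω | e ω ∈ A} = φ^{e B}_{𝐩,q}(A)`. [cite: Grimmett2006, §4.3] -/
theorem rcMeasureW_real_preimage_relabel (e : V ≃ W) (w : Sym2 W → unitInterval) {q : ℝ} (hq : 0 < q) (B : Set V)
    (A : Set (BondConfig W)) :
    (rcMeasureW (w ∘ sym2Equiv e) q B).real (BondConfig.relabel (sym2Equiv e) ⁻¹' A) = (rcMeasureW w q (e '' B)).real A := by
  classical
  rw [rcMeasureW_real_apply _ hq, rcMeasureW_real_apply _ hq, rcPartitionFunctionW_relabel e w q B]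
  refine Fintype.sum_equiv (BondConfig.relabel (sym2Equiv e)).toEquiv _ _ fun ω => ?_
  simp only [Set.mem_preimage, MeasurableEquiv.coe_toEquiv, rcWeightW_relabel e w q B ω]

/-- **Push-forward form**: `(φ^B_{𝐩∘e,q}).map (ω ↦ e ω) = φ^{e B}_{𝐩,q}` (`0 < q`). [cite: Grimmett2006, §4.3] -/
theorem rcMeasureW_map_relabel (e : V ≃ W) (w : Sym2 W → unitInterval) {q : ℝ} (hq : 0 < q) (B : Set V) :
    (rcMeasureW (w ∘ sym2Equiv e) q B).map (BondConfig.relabel (sym2Equiv e)) = rcMeasureW w q (e '' B) := by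
  haveI := isProbabilityMeasure_rcMeasureW (w ∘ sym2Equiv e) hq B
  haveI := isProbabilityMeasure_rcMeasureW w hq (e '' B)
  refine Measure.ext fun A hA => ?_
  have h := rcMeasureW_real_preimage_relabel e w hq B A
  rw [measureReal_def, measureReal_def, ENNReal.toReal_eq_toReal_iff' (measure_ne_top _ _) (measure_ne_top _ _)] at h
  rw [Measure.map_apply (BondConfig.relabel (sym2Equiv e)).measurable hA]
  exact h

/-- **Integrals under relabelling**: `∫ g dφ^{e B}_{𝐩,q} = ∫ g(e ω) dφ^B_{𝐩∘e,q}(ω)` (`0 < q`). [cite: Grimmett2006, §4.3] -/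
theorem integral_rcMeasureW_relabel (e : V ≃ W) (w : Sym2 W → unitInterval) {q : ℝ} (hq : 0 < q) (B : Set V)
    (g : BondConfig W → ℝ) :
    ∫ ω', g ω' ∂(rcMeasureW w q (e '' B)) = ∫ ω, g (BondConfig.relabel (sym2Equiv e) ω) ∂(rcMeasureW (w ∘ sym2Equiv e) q B) := by
  rw [← rcMeasureW_map_relabel e w hq B, integral_map_equiv]

/-- **Restricted integrals under relabelling**: `∫_A g dφ^{e B}_{𝐩,q} = ∫_{e⁻¹ A} g(e ω) dφ^B_{𝐩∘e,q}(ω)` (`0 < q`). [cite: Grimmett2006, §4.3] -/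
theorem setIntegral_rcMeasureW_relabel (e : V ≃ W) (w : Sym2 W → unitInterval) {q : ℝ} (hq : 0 < q) (B : Set V)
    (g : BondConfig W → ℝ) (A : Set (BondConfig W)) :
    ∫ ω' in A, g ω' ∂(rcMeasureW w q (e '' B)) =
      ∫ ω in BondConfig.relabel (sym2Equiv e) ⁻¹' A, g (BondConfig.relabel (sym2Equiv e) ω) ∂(rcMeasureW (w ∘ sym2Equiv e) q B) := by
  rw [← rcMeasureW_map_relabel e w hq B, MeasurableEquiv.restrict_map, integral_map_equiv]

end Literature.Probability.LatticeModels

end
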